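import Summits.AtomisticToContinuum.HydrodynamicLimit.Theorems.CollisionIsometryCLTCollisionalTransferLocalityFluxForm
import Summits.AtomisticToContinuum.HydrodynamicLimit.Theorems.CollisionIsometryCLTCollisionalTransferLocalityChannelAdditivity
import Literature.Analysis.FunctionSpaces.TorusSpaceTime
import HarnessLib

/-!
# Vocabulary of the line `hemisphere-affine-slaving`, part E: even rank-2 marks with a general matrix weight
(crux `CollisionalTransferLocality`, stmt-AtomisticToContinuum-9518; rank 3 of route `StiffCollisionalRelaxation`,
rank 4 of `CollisionIsometryCLT` — the two route decls are `rfl`-equal)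

Definitions-only support file (`--supports stmt-AtomisticToContinuum-9518`) of the line lead (gen 1, seat c10),
continuing `…Defs` (p77328), `…DefsB`, `…DefsC`, `…DefsD`. It makes importable the vocabulary of the v18 reshape of
the momentum engine stub [Kσ] `stub_collisionalStressLaw` (the marked Campbell law of the MOMENTUM channel, uniformly in
`τ ≤ t`, for the gradient marks `‖Δv_i‖ ω⊗ω : ∇ψ(s, x_i)`) into its ENGINE-NATURAL form [KσA] `stub_stressLawFixedA`:
the same law at a FIXED time `τ` for the even rank-2 marks `‖Δv_i‖ ω⊗ω : A(s, x_i)` with an ARBITRARY space–time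
smooth matrix weight `A` — exactly the mark family `Ξ^{kl} = ((w−v)·n̂)₊ n̂_k n̂_l` with weights `χ_{kl}` of the
sibling crux `JParityClosure.EvenStressEnskog` (stmt-13079), read at mesoscale `(N+1)^{-γ}` — with the value
`∫₀^τ∫ [tr A · p_c(ρ̄, θ̄) + (2/5)(Z(ρ̄σ³) − 1) D̄ : A]` (Enskog's collisional transfer for a general symmetric
weight: `∫_{S²}(g·ω)₊² ω_k ω_l dω = (2π/15)(|g|²δ_kl + 2 g_k g_l)`, Chapman–Cowling 1970 §16.4; the trace part is the
collisional pressure, the traceless part the kinetic correction removed by 9522). The sup over `τ` and the gradient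
structure of [Kσ] then become provable glue: the isotropic instance `A = 𝟙` is (one half of) the plain collision virial,
whose fixed-time law plus the deterministic Lipschitz envelope of its value forbids bursts, and a grid argument
(`exists_grid_index_of_dominated_increments`) upgrades fixed-time laws to the uniform one.

* `markA σ A N s w i j = (ε_N/2) ‖Δv_i‖ Σ_ab ω_a ω_b A(s, x_i)_ab` — the flux-form mark kernel with weight `A`
  (`markK σ ψ 0 = markA σ (gradPsi ψ)`, `markK_zero_eq_markA`), and its normalised collision sum `MfunA`
  (`Mfun σ Φ ψ 0 = MfunA σ Φ (gradPsi ψ)`, `Mfun_zero_eq_MfunA`);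
* `trW A s x = Σ_a A(s,x)_aa`, `kinWA A = (2/5)(D̄ : A)/(ρ̄θ̄)` — the Euler and kinetic-correction weights of `A`
  (`eulerW ψ 0 = trW (gradPsi ψ)` for smooth slices, `kinW ψ 0 = kinWA (gradPsi ψ)`);
* `RhsA`, `KfunA` — the value functionals `∫₀^τ∫ tr A · p_c(ρ̄, θ̄)`, `∫₀^τ∫ kinWA · p_c(ρ̄, θ̄)`
  (`Rhs σ Φ φ ψ 0 … τ = RhsA σ Φ φ (gradPsi ψ) … τ` for `τ ≤ t` and `ψ` smooth on `[0, t]`; `Kfun σ Φ φ ψ 0 = KfunA …`);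
* `isoW` — the isotropic weight `δ_ab` (`markA σ isoW ≥ 0`: the plain collision virial `(ε_N/2)‖Δv_i‖‖ω‖²`);
* `SmoothMatrixOn S A` — componentwise space–time smoothness; `StressLawFixedAAt σ a₀ θ₀ u₀ Φ φ t A` — THE FIXED-TIME
  MOMENTUM LAW at one `(σ, profiles, Φ, kernel, t, A)`: at each `τ ∈ [0, t]`, `MfunA(τ) − (RhsA(τ) + KfunA(τ)) → 0` in
  local-Gibbs probability.
Nothing in this file is asserted: every `def … : Prop` is a predicate the stubs prove or consume. The lemmas are the
definitional bridges to the `(ψ, χ)`-keyed vocabulary of `…Defs`/`…DefsC` (finite-sum bookkeeping, `∇0 = 0` from `…ChannelAdditivity`,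
`div ψ = tr ∇ψ` for smooth slices).
-/

namespace Summit.AtomisticToContinuum.HydrodynamicLimit.Theorems.HemisphereAffineSlaving

open scoped BigOperators Topology Classical ENNReal InnerProductSpace
open Filter Set Function MeasureTheory
open Literature.Analysis.FunctionSpaces

noncomputable section

open Literature.MathematicalPhysics.KineticTheory (T3 V3 hsDiameter)

/-! ## The mark kernel with a general matrix weight -/

/-- FLUX-FORM MARK KERNEL WITH MATRIX WEIGHT `A : ℝ → 𝕋³ → (Fin 3 → Fin 3 → ℝ)` per ordered contact pair:
`(ε_N/2) · ‖Δv_i‖ · Σ_ab ω_a ω_b A(s, x_i)_ab` (`markK σ ψ 0` is the case `A = ∇ψ`, `markK_zero_eq_markA`). -/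
def markA (σ : ℝ) (A : ℝ → T3 → Fin 3 → Fin 3 → ℝ) (N : ℕ) (s : ℝ) (w : Cfg N) (i j : Fin (N + 1)) : ℝ :=
  hsDiameter σ N / 2 * ‖dV N w i j‖ * ∑ a, ∑ b, omg N w i j a * omg N w i j b * A s (w i).1 a b

/-- `M_N^A(z, τ)`: the flux-form mark sum with weight `A` over the ordered contact pairs of the orbit of `z` with
collision times in `(0, τ]`, normalised by `(N+1)⁻¹` (same shape as `Mfun`). -/
def MfunA (σ : ℝ) (Φ : Flows σ) (A : ℝ → T3 → Fin 3 → Fin 3 → ℝ) (N : ℕ) (z : Cfg N) (τ : ℝ) : ℝ :=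
  ((N : ℝ) + 1)⁻¹ * (Φ N).collisionPairSum (Ioc 0 τ) (markA σ A N) z

/-- The trace weight `tr A(s, x) = Σ_a A(s, x)_aa` (`= div ψ` for `A = ∇ψ` with a smooth slice, `eulerW_zero_eq_trW`). -/
def trW (A : ℝ → T3 → Fin 3 → Fin 3 → ℝ) (s : ℝ) (x : T3) : ℝ :=
  ∑ a, A s x a a

/-- The kinetic-correction weight of `A`: `(2/5) (D̄ : A)/(ρ̄θ̄)` (`kinW ψ 0 = kinWA (gradPsi ψ)`, `kinW_zero_eq_kinWA`). -/
def kinWA (A : ℝ → T3 → Fin 3 → Fin 3 → ℝ) (φ : ℕ → T3 → ℝ) (N : ℕ) (s : ℝ) (z : Cfg N) (x : T3) : ℝ :=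
  2 / 5 * (∑ a, ∑ b, Dst φ N z x a b * A s x a b) / pkin φ N z x

/-- `RhsA_N(z, τ) = ∫₀^τ ∫ tr A · p_c(ρ̄, θ̄)` — the Euler value of the weight `A` (the collisional pressure tested
against `tr A`; `Rhs σ Φ φ ψ 0` for `A = ∇ψ`, `Rhs_zero_eq_RhsA`). -/
def RhsA (σ : ℝ) (Φ : Flows σ) (φ : ℕ → T3 → ℝ) (A : ℝ → T3 → Fin 3 → Fin 3 → ℝ) (N : ℕ) (z : Cfg N)
    (τ : ℝ) : ℝ :=
  ∫ s in Icc 0 τ, ∫ x, trW A s x * pcoll σ (rhoB φ N ((Φ N).flow s z) x) (thetaB φ N ((Φ N).flow s z) x)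

/-- `KfunA_N(z, τ) = ∫₀^τ ∫ kinWA · p_c(ρ̄, θ̄) = ∫₀^τ∫ (2/5)(Z(ρ̄σ³) − 1) D̄ : A` — the kinetic-correction value of
the weight `A` (`Kfun σ Φ φ ψ 0` for `A = ∇ψ`, `Kfun_zero_eq_KfunA`). -/
def KfunA (σ : ℝ) (Φ : Flows σ) (φ : ℕ → T3 → ℝ) (A : ℝ → T3 → Fin 3 → Fin 3 → ℝ) (N : ℕ) (z : Cfg N)
    (τ : ℝ) : ℝ :=
  ∫ s in Icc 0 τ, ∫ x, kinWA A φ N s ((Φ N).flow s z) x *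
    pcoll σ (rhoB φ N ((Φ N).flow s z) x) (thetaB φ N ((Φ N).flow s z) x)

/-- The ISOTROPIC weight `δ_ab`: `markA σ isoW = (ε_N/2)‖Δv_i‖ ‖ω‖²` is one half of the plain collision-virial
kernel, `tr isoW = 3`, `kinWA isoW = 0` (`D̄` is traceless). -/
def isoW : ℝ → T3 → Fin 3 → Fin 3 → ℝ :=
  fun _ _ a b => if a = b then 1 else 0

/-- Componentwise space–time smoothness of a matrix weight on the time set `S`. -/
def SmoothMatrixOn (S : Set ℝ) (A : ℝ → T3 → Fin 3 → Fin 3 → ℝ) : Prop :=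
  ∀ a b, Torus.IsSmoothSpaceTimeOn S (fun s x => A s x a b)

/-- **[KσA] at one `(σ, profiles, Φ, kernel, t, A)`: THE FIXED-TIME MOMENTUM LAW.** At each fixed `τ ∈ [0, t]`,
`M_N^A(τ) − (RhsA_N(τ) + KfunA_N(τ)) → 0` in local-Gibbs probability: the `(ε/2)‖Δv‖`-weighted empirical law of
the contact normals and places of the collisions up to time `τ`, tested against the even rank-2 marks `ω⊗ω` with the
block-smooth matrix coefficients `A(s, x_i)`, takes its Enskog value — contact intensity `ρ̄ Y(ρ̄σ³)` at the block's
own density, isotropic normals (trace part `tr A · p_c`), the traceless second moment slaved to the block kinetic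
stress (`(2/5)(Z−1) D̄ : A`). The `EvenStressEnskog` statement (13079) for the marks `Ξ^{kl}` with weights
`½ A_kl`, read at MESOSCALE. -/
def StressLawFixedAAt (σ : ℝ) (a₀ θ₀ : T3 → ℝ) (u₀ : T3 → V3) (Φ : Flows σ) (φ : ℕ → T3 → ℝ) (t : ℝ)
    (A : ℝ → T3 → Fin 3 → Fin 3 → ℝ) : Prop :=
  ∀ τ ∈ Icc 0 t, ∀ δ : ℝ, 0 < δ → Tendsto (fun N : ℕ =>
    Literature.MathematicalPhysics.KineticTheory.localGibbsLaw σ a₀ u₀ θ₀ N (Φ N)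
      {z | δ < |MfunA σ Φ A N z τ - (RhsA σ Φ φ A N z τ + KfunA σ Φ φ A N z τ)|}) atTop (𝓝 0)

/-! ## Bridges to the `(ψ, χ)`-keyed vocabulary (sorry-free bookkeeping) -/

/-- The momentum-channel mark kernel IS the mark kernel with the gradient weight: `markK σ ψ 0 = markA σ (∇ψ)`. -/
theorem markK_zero_eq_markA (σ : ℝ) (ψ : ℝ → T3 → V3) (N : ℕ) :
    markK σ ψ (fun (_ : ℝ) (_ : T3) => (0 : ℝ)) N = markA σ (gradPsi ψ) N := by
  funext s w i j
  simp only [markK, markA, ChannelAdditivity.gradChi_zero, PiLp.zero_apply, mul_zero, Finset.sum_const_zero, add_zero]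

/-- Hence `Mfun σ Φ ψ 0 = MfunA σ Φ (∇ψ)` (as functions of `N, z, τ`). -/
theorem Mfun_zero_eq_MfunA (σ : ℝ) (Φ : Flows σ) (ψ : ℝ → T3 → V3) :
    Mfun σ Φ ψ (fun (_ : ℝ) (_ : T3) => (0 : ℝ)) = MfunA σ Φ (gradPsi ψ) := by
  funext N z τ
  simp only [Mfun, MfunA, markK_zero_eq_markA]

/-- The kinetic-correction weight of the momentum channel IS `kinWA (∇ψ)`: `kinW ψ 0 = kinWA (gradPsi ψ)`. -/
theorem kinW_zero_eq_kinWA (ψ : ℝ → T3 → V3) (φ : ℕ → T3 → ℝ) (N : ℕ) :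
    kinW ψ (fun (_ : ℝ) (_ : T3) => (0 : ℝ)) φ N = kinWA (gradPsi ψ) φ N := by
  funext s z x
  simp only [kinW, kinWA, ChannelAdditivity.gradChi_zero, PiLp.zero_apply, mul_zero, Finset.sum_const_zero, add_zero,
    zero_div, mul_zero]

/-- Hence `Kfun σ Φ φ ψ 0 = KfunA σ Φ φ (∇ψ)`. -/
theorem Kfun_zero_eq_KfunA (σ : ℝ) (Φ : Flows σ) (φ : ℕ → T3 → ℝ) (ψ : ℝ → T3 → V3) :
    Kfun σ Φ φ ψ (fun (_ : ℝ) (_ : T3) => (0 : ℝ)) = KfunA σ Φ φ (gradPsi ψ) := by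
  funext N z τ
  simp only [Kfun, KfunA, kinW_zero_eq_kinWA]

/-- For a test with a SMOOTH slice `ψ s`, the Euler weight of the momentum channel is the trace of the gradient weight:
`eulerW ψ 0 … s … x = div ψ(s, x) = Σ_a ∂_aψ_a(s, x) = trW (∇ψ) s x` (components of the Fréchet gradient are the
partial derivatives for `C¹` slices, `gradient_apply_eq_partialDeriv`; for a non-differentiable slice the two junk
values may differ, whence the hypothesis). -/
theorem eulerW_zero_eq_trW {ψ : ℝ → T3 → V3} {s : ℝ} (hψ : ∀ a, Torus.IsSmooth fun y => ψ s y a)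
    (φ : ℕ → T3 → ℝ) (N : ℕ) (z : Cfg N) (x : T3) :
    eulerW ψ (fun (_ : ℝ) (_ : T3) => (0 : ℝ)) φ N s z x = trW (gradPsi ψ) s x := by
  simp only [eulerW, trW, ChannelAdditivity.gradChi_zero, PiLp.zero_apply, zero_mul, Finset.sum_const_zero, add_zero, divPsi,
    Torus.divergence, gradPsi]
  refine Finset.sum_congr rfl fun a _ => ?_
  rw [gradient_apply_eq_partialDeriv ((hψ a).isContDiff (by simp))]

/-- Hence, for a test `ψ` that is space–time smooth on `[0, t]` and `τ ≤ t`: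
`Rhs σ Φ φ ψ 0 N z τ = RhsA σ Φ φ (∇ψ) N z τ` (the slice integrands agree for every `s ∈ [0, τ] ⊆ [0, t]`). -/
theorem Rhs_zero_eq_RhsA {t : ℝ} {ψ : ℝ → T3 → V3} (hψ : Torus.IsSmoothSpaceTimeOn (Icc 0 t) ψ)
    (σ : ℝ) (Φ : Flows σ) (φ : ℕ → T3 → ℝ) (N : ℕ) (z : Cfg N) {τ : ℝ} (hτ : τ ≤ t) :
    Rhs σ Φ φ ψ (fun (_ : ℝ) (_ : T3) => (0 : ℝ)) N z τ = RhsA σ Φ φ (gradPsi ψ) N z τ := by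
  unfold Rhs RhsA
  refine setIntegral_congr_fun measurableSet_Icc fun s hs => ?_
  have hs' : s ∈ Icc 0 t := ⟨hs.1, hs.2.trans hτ⟩
  have hsl : ∀ a, Torus.IsSmooth fun y => ψ s y a := fun a => (hψ.isSmooth_slice hs').apply a
  simp only [eulerW_zero_eq_trW hsl]

/-! ## The isotropic instance and smooth instances -/

/-- `Σ_ab ω_a ω_b δ_ab = ‖ω‖²`. [folklore] -/
theorem sum_omg_isoW (N : ℕ) (w : Cfg N) (i j : Fin (N + 1)) (s : ℝ) :
    ∑ a, ∑ b, omg N w i j a * omg N w i j b * isoW s (w i).1 a b = ‖omg N w i j‖ ^ 2 := by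
  simp only [isoW, mul_ite, mul_one, mul_zero, Finset.sum_ite_eq, Finset.mem_univ, if_true]
  rw [EuclideanSpace.norm_eq, Real.sq_sqrt (Finset.sum_nonneg fun a _ => sq_nonneg _)]
  exact Finset.sum_congr rfl fun a _ => by rw [Real.norm_eq_abs, sq_abs, sq]

/-- The isotropic mark kernel: `markA σ isoW N s w i j = (ε_N/2) ‖Δv_i‖ ‖ω‖²`. -/
theorem markA_isoW (σ : ℝ) (N : ℕ) (s : ℝ) (w : Cfg N) (i j : Fin (N + 1)) :
    markA σ isoW N s w i j = hsDiameter σ N / 2 * ‖dV N w i j‖ * ‖omg N w i j‖ ^ 2 := by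
  rw [markA, sum_omg_isoW]

/-- **Registered helper `markA_isoW_nonneg`.** The isotropic mark kernel is nonnegative for `σ ≥ 0` (so the
isotropic mark sum `MfunA σ Φ isoW` — one half of the plain collision virial — is monotone in `τ` on good orbits). -/
theorem markA_isoW_nonneg : ∀ {σ : ℝ}, 0 ≤ σ → ∀ (N : ℕ) (s : ℝ) (w : Cfg N) (i j : Fin (N + 1)), 0 ≤ markA σ isoW N s w i j := by
  intro σ hσ N s w i j
  rw [markA_isoW]
  unfold Literature.MathematicalPhysics.KineticTheory.hsDiameter
  positivity

/-- The trace of the isotropic weight is `3`. -/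
theorem trW_isoW (s : ℝ) (x : T3) : trW isoW s x = 3 := by
  simp [trW, isoW]

/-- The isotropic weight is space–time smooth on every time set (constant components). [folklore] -/
theorem smoothMatrixOn_isoW (S : Set ℝ) : SmoothMatrixOn S isoW := by
  intro a b
  by_cases h : a = b
  · simpa [isoW, h] using Torus.isSmoothSpaceTimeOn_const (Torus.isSmooth_const (1 : ℝ)) S
  · simpa [isoW, h] using Torus.isSmoothSpaceTimeOn_const (Torus.isSmooth_const (0 : ℝ)) S

/-- The gradient weight of a space–time smooth vector test on `[0, t]` (`t > 0`) is space–time smooth on `[0, t]`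
(`∂_b` of the jointly smooth component `ψ_a`, `IsSmoothSpaceTimeOn.gradient`). [folklore] -/
theorem smoothMatrixOn_gradPsi {t : ℝ} (ht : 0 < t) {ψ : ℝ → T3 → V3}
    (hψ : Torus.IsSmoothSpaceTimeOn (Icc 0 t) ψ) : SmoothMatrixOn (Icc 0 t) (gradPsi ψ) := by
  intro a b
  have ha : Torus.IsSmoothSpaceTimeOn (Icc 0 t) (fun s x => ψ s x a) := hψ.apply a
  exact (ha.gradient (uniqueDiffOn_Icc ht)).apply b

end

end Summit.AtomisticToContinuum.HydrodynamicLimit.Theorems.HemisphereAffineSlaving
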